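import Summits.HubbardSuperconductivity.HubbardSuperconductivity.Theorems.KLProgrammeKLRegimeScaleZeroCovarianceKernelFreqJetsDecay
import Literature.Analysis.Fourier.FermionicPoissonSummationDecay

/-!
# Route `KLProgramme`, crux K3 — engine-flow child (stmt-HubbardSuperconductivity-20437), stub (C) at `n = 0`, located brick «A-SIZES-WEIGHTED» (pen (R181)),
# brick 3: JOINT SPACE–TIME DECAY of the `β = ∞` infinite-lattice kernel — `|t|ᴺ·‖𝓕(a_·(z))(t/2π)‖ ≤ ∫‖∂_ωᴺ a_ω(z)‖dω ≤ K_{N,n}·(1+‖z‖)⁻ⁿ`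

Cell gate-hubbard-kl, seat p1 g20.  The general-`N` twin of `Literature.Analysis.Fourier.norm_fourier_le_integral_iteratedDeriv_two` (D4; Mathlib
`Real.fourier_iteratedDeriv`), applied to `G = ω ↦ a_ω(z)` (`z ≠ 0`) with brick 2's off-site bound `‖∂_ωᴺa_ω(z)‖ ≤ D_{N,n}(ω)(1+‖z‖)⁻ⁿ`,
`D_{N,n}(ω) = O(m(ω)^{−N−2})`, integrable in `ω`:

* `norm_fourier_le_integral_iteratedDeriv_pow`, `norm_fourier_div_two_pi_le_pow` — `‖𝓕G(t/2π)‖ ≤ (∫‖G^{(N)}‖)/|t|ᴺ` (`t ≠ 0`, `G ∈ Cᴺ`, jets integrable);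
* **`norm_fourier_latticeKernel_le_pow_offSite`** — `‖𝓕(a_·(z))(t/2π)‖ ≤ (∫‖∂_ωᴺa_ω(z)‖dω)/|t|ᴺ` for `z ≠ 0`, every `N` (table to order `max N 2`);
* **`integral_norm_iteratedDeriv_latticeKernel_le_offSite`** — `∫‖∂_ωᴺ a_ω(z)‖dω ≤ [n!·cB(N+n+1)!·(2πD_K)ⁿ/πⁿ·2^{N+2}·max(1,4/Λ)^{n−1}·∫m(ω)^{−N−2}dω]·(1+‖z‖)⁻ⁿ`
  (`n ≥ 1`; the remaining one-dimensional integral `∫ max(|ω|,Λ/2)^{−N−2}dω = (2/Λ)^{N+1}·(2 + 2/(N+1))` is left as the symbol — finite by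
  `integrable_one_div_max_abs_pow`);
so `ǧ(z,t) = (1/2π)𝓕G(t/2π)` obeys `|ǧ(z,t)| ≤ K_{N,n}(1+‖z‖_∞)⁻ⁿ|t|⁻ᴺ` with `β`-, `M`-, `L`-free `K_{N,n}` — the input of the weighted `a`-sizes (brick 4).

Proofs only; no definitions; nothing here asserts (C), any stub of 20437, K3 or superconductivity.  References: Stein–Weiss 1971 I Thm 1.8 [cite: SteinWeiss1971];
BGM 2006 §2.2 (2.36aa) [cite: BenfattoGiulianiMastropietro2006].
-/

noncomputable section

namespace Summit.HubbardSuperconductivity.HubbardSuperconductivity.Theorems.KLRegimeSplit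

set_option linter.dupNamespace false -- summit = problem name (single-conjunct summit), D-0017

open Literature.MathematicalPhysics.QuantumLattice Literature.Probability.LatticeModels Literature.Analysis.FunctionSpaces
open Summit.HubbardSuperconductivity.HubbardSuperconductivity.Theorems.DispersionFlow
open Summit.HubbardSuperconductivity.HubbardSuperconductivity.Theorems.EngineV8 (norm_iteratedFDeriv_frameLevel_zero_le)
open MeasureTheory Set Complex UnitAddTorus Real
open scoped FourierTransform Nat

/-! ## §1 `N` integrable derivatives give `|ξ|^{-N}` Fourier decay -/

/-- **`‖𝓕G(ξ)‖ ≤ ‖G^{(N)}‖_{L¹}/(2π|ξ|)ᴺ`** for `ξ ≠ 0`, `G ∈ Cᴺ(ℝ)` with `G, G′, …, G^{(N)}` integrable (Mathlib `Real.fourier_iteratedDeriv`). -/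
theorem norm_fourier_le_integral_iteratedDeriv_pow {G : ℝ → ℂ} {N : ℕ} (hG : ContDiff ℝ N G)
    (hint : ∀ n : ℕ, n ≤ N → Integrable (iteratedDeriv n G)) {ξ : ℝ} (hξ : ξ ≠ 0) :
    ‖𝓕 G ξ‖ ≤ (∫ x : ℝ, ‖iteratedDeriv N G x‖) / (2 * π * |ξ|) ^ N := by
  have key := congrFun (Real.fourier_iteratedDeriv (N := ((N : ℕ) : ℕ∞)) (n := N) hG
    (fun n hn => hint n (by exact_mod_cast hn)) le_rfl) ξ
  have hnorm : ‖𝓕 (iteratedDeriv N G) ξ‖ ≤ ∫ x : ℝ, ‖iteratedDeriv N G x‖ :=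
    VectorFourier.norm_fourierIntegral_le_integral_norm _ _ _ _ _
  rw [key, norm_smul, norm_pow] at hnorm
  have hc : ‖2 * (π : ℂ) * I * ξ‖ = 2 * π * |ξ| := by
    rw [norm_mul, norm_mul, norm_mul, Complex.norm_I, mul_one, Complex.norm_real, Real.norm_eq_abs, Complex.norm_real,
      Real.norm_eq_abs, abs_of_pos Real.pi_pos, Complex.norm_ofNat]
  rw [hc] at hnorm
  have hpos : 0 < (2 * π * |ξ|) ^ N := by
    have : 0 < |ξ| := abs_pos.2 hξ
    positivity
  rw [le_div_iff₀ hpos, mul_comm]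
  exact hnorm

/-- The same in the Matsubara normalisation: `‖𝓕G(t/2π)‖ ≤ ‖G^{(N)}‖_{L¹}/|t|ᴺ` for `t ≠ 0`. -/
theorem norm_fourier_div_two_pi_le_pow {G : ℝ → ℂ} {N : ℕ} (hG : ContDiff ℝ N G)
    (hint : ∀ n : ℕ, n ≤ N → Integrable (iteratedDeriv n G)) {t : ℝ} (ht : t ≠ 0) :
    ‖𝓕 G (t / (2 * π))‖ ≤ (∫ x : ℝ, ‖iteratedDeriv N G x‖) / |t| ^ N := by
  have hπ : 0 < π := Real.pi_pos
  have h := norm_fourier_le_integral_iteratedDeriv_pow hG hint (ξ := t / (2 * π)) (by positivity)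
  have heq : (2 * π * |t / (2 * π)|) ^ N = |t| ^ N := by
    rw [abs_div, abs_of_pos (by positivity : (0 : ℝ) < 2 * π), mul_div_cancel₀ _ (by positivity : (2 : ℝ) * π ≠ 0)]
  rwa [heq] at h

/-! ## §2 The lattice kernel: time decay from `N` frequency derivatives, jointly with the off-site spatial decay -/

/-- **`‖𝓕(a_·(z))(t/2π)‖ ≤ (∫‖∂_ωᴺ a_ω(z)‖dω)/|t|ᴺ`** for `z ≠ 0`, `t ≠ 0`, every `N` (cutoff table to order `max N 2`, first band jet `D_K`). -/
theorem norm_fourier_latticeKernel_le_pow_offSite {c Λ : ℝ} (hc : 0 ≤ c) (hΛ : 0 < Λ) (μ : ℝ) (K : TrigPolyC4v) (N : ℕ) {B : ℝ} (hB1 : 1 ≤ B)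
    (hB : ∀ i ≤ max N 2, ∀ t, ‖iteratedDeriv i salmhoferCutoff t‖ ≤ B) {DK : ℝ} (hK : ∀ q : Momentum, ‖iteratedFDeriv ℝ 1 (frameLevel μ K) q‖ ≤ DK)
    {z : Site 2} (hz : z ≠ 0) {t : ℝ} (ht : t ≠ 0) :
    ‖𝓕 (fun om : ℝ => mFourierCoeff (Torus.descend (fun y : Momentum => uvSymbolFn c Λ (frameLevel μ K ((2 * π) • y)) om)
        (uvSpatialSymbol_isLatticePeriodic c Λ μ K om)) z) (t / (2 * π))‖ ≤
      (∫ om : ℝ, ‖iteratedDeriv N (fun om : ℝ => mFourierCoeff (Torus.descend (fun y : Momentum => uvSymbolFn c Λ (frameLevel μ K ((2 * π) • y)) om)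
        (uvSpatialSymbol_isLatticePeriodic c Λ μ K om)) z) om‖) / |t| ^ N := by
  refine norm_fourier_div_two_pi_le_pow ((contDiff_latticeKernel_freq c hΛ μ K z).of_le (by exact_mod_cast le_top)) (fun n hn => ?_) ht
  rcases Nat.eq_zero_or_pos n with rfl | hn1
  · rw [iteratedDeriv_zero]
    exact integrable_latticeKernel_freq_of_ne_zero hc hΛ μ K hB1 (fun i hi t => hB i (hi.trans (by omega)) t) hK hz
  · exact integrable_iteratedDeriv_latticeKernel_freq_of_one_le hc hΛ μ K z hn1 hB1 (fun i hi t => hB i (hi.trans ((hn.trans (le_max_left _ _)))) t)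

/-- **`∫‖∂_ωᴺ a_ω(z)‖dω ≤ K·(1+‖z‖)⁻ⁿ` off site** (`z ≠ 0`, `n ≥ 1`): with brick 2's pointwise bound and `max(1,2/m) ≤ max(1,4/Λ)`,
`∫‖∂_ωᴺ a_ω(z)‖ ≤ [n!·c·B·(N+n+1)!·(2πD_K)ⁿ/πⁿ·2^{N+2}·max(1,4/Λ)^{n−1}·∫ max(|ω|,Λ/2)^{−(N+2)}dω]·(1+‖z‖)⁻ⁿ`. -/
theorem integral_norm_iteratedDeriv_latticeKernel_le_offSite {c Λ : ℝ} (hc : 0 ≤ c) (hΛ : 0 < Λ) (μ : ℝ) (K : TrigPolyC4v) (N : ℕ) {n : ℕ}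
    (hn1 : 1 ≤ n) {B : ℝ} (hB1 : 1 ≤ B) (hB : ∀ j ≤ N + n, ∀ t, ‖iteratedDeriv j salmhoferCutoff t‖ ≤ B) {DK : ℝ} (hDK : 0 ≤ DK)
    (hK : ∀ i : ℕ, 1 ≤ i → i ≤ n → ∀ q : Momentum, ‖iteratedFDeriv ℝ i (frameLevel μ K) q‖ ≤ DK ^ i) {z : Site 2} (hz : z ≠ 0) :
    ∫ om : ℝ, ‖iteratedDeriv N (fun om : ℝ => mFourierCoeff (Torus.descend (fun y : Momentum => uvSymbolFn c Λ (frameLevel μ K ((2 * π) • y)) om)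
        (uvSpatialSymbol_isLatticePeriodic c Λ μ K om)) z) om‖ ≤
      (n ! * (c * B * (N + n + 1) !) * ((2 * π) * DK) ^ n / Real.pi ^ n * 2 ^ (N + 2) * (max 1 (4 / Λ)) ^ (n - 1) *
        ∫ om : ℝ, 1 / max |om| (Λ / 2) ^ (N + 2)) * ((1 + ‖z‖) ^ n)⁻¹ := by
  have hB0 : 0 ≤ B := zero_le_one.trans hB1
  set A : ℝ := n ! * (c * B * (N + n + 1) !) * ((2 * π) * DK) ^ n / Real.pi ^ n * 2 ^ (N + 2) * (max 1 (4 / Λ)) ^ (n - 1) with hA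
  have hA0 : 0 ≤ A := by positivity
  have hint : Integrable (fun om : ℝ => A * ((1 + ‖z‖) ^ n)⁻¹ * (1 / max |om| (Λ / 2) ^ (N + 2))) :=
    (integrable_one_div_max_abs_pow (half_pos hΛ) (p := N + 2) (by omega)).const_mul _
  have hpt : ∀ om : ℝ, ‖iteratedDeriv N (fun om : ℝ => mFourierCoeff (Torus.descend (fun y : Momentum => uvSymbolFn c Λ (frameLevel μ K ((2 * π) • y)) om)
        (uvSpatialSymbol_isLatticePeriodic c Λ μ K om)) z) om‖ ≤ A * ((1 + ‖z‖) ^ n)⁻¹ * (1 / max |om| (Λ / 2) ^ (N + 2)) := by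
    intro om
    refine (norm_iteratedDeriv_latticeKernel_freq_le_offSite hc hΛ μ K N hn1 hB1 hB hK hz om).trans ?_
    have hm : 0 < max |om| (Λ / 2) := lt_max_of_lt_right (by positivity)
    have hq : max 1 (2 / max |om| (Λ / 2)) ≤ max 1 (4 / Λ) := by
      refine max_le_max le_rfl ?_
      rw [div_le_div_iff₀ hm hΛ]; nlinarith [le_max_right |om| (Λ / 2)]
    have hq0 : 0 ≤ max 1 (2 / max |om| (Λ / 2)) := le_trans zero_le_one (le_max_left _ _)
    rw [hA]
    have h2 : (2 / max |om| (Λ / 2)) ^ (N + 2) = 2 ^ (N + 2) * (1 / max |om| (Λ / 2) ^ (N + 2)) := by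
      rw [div_pow]; ring
    calc (n ! : ℝ) * (c * B * (N + n + 1) ! * (2 / max |om| (Λ / 2)) ^ (N + 2) * (max 1 (2 / max |om| (Λ / 2))) ^ (n - 1)) * ((2 * π) * DK) ^ n /
          Real.pi ^ n * ((1 + ‖z‖) ^ n)⁻¹
        ≤ (n ! : ℝ) * (c * B * (N + n + 1) ! * (2 / max |om| (Λ / 2)) ^ (N + 2) * (max 1 (4 / Λ)) ^ (n - 1)) * ((2 * π) * DK) ^ n /
          Real.pi ^ n * ((1 + ‖z‖) ^ n)⁻¹ := by
          gcongr
      _ = _ := by rw [h2]; ring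
  calc ∫ om : ℝ, ‖iteratedDeriv N (fun om : ℝ => mFourierCoeff (Torus.descend (fun y : Momentum => uvSymbolFn c Λ (frameLevel μ K ((2 * π) • y)) om)
        (uvSpatialSymbol_isLatticePeriodic c Λ μ K om)) z) om‖
      ≤ ∫ om : ℝ, A * ((1 + ‖z‖) ^ n)⁻¹ * (1 / max |om| (Λ / 2) ^ (N + 2)) :=
        integral_mono_of_nonneg (ae_of_all _ fun om => norm_nonneg _) hint (ae_of_all _ hpt)
    _ = A * ((1 + ‖z‖) ^ n)⁻¹ * ∫ om : ℝ, 1 / max |om| (Λ / 2) ^ (N + 2) := integral_const_mul _ _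
    _ = (A * ∫ om : ℝ, 1 / max |om| (Λ / 2) ^ (N + 2)) * ((1 + ‖z‖) ^ n)⁻¹ := by ring

end Summit.HubbardSuperconductivity.HubbardSuperconductivity.Theorems.KLRegimeSplit

end
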